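import Literature.RepresentationTheory.HeisenbergGroup.SchrodingerLeraySectionGram
import Literature.RepresentationTheory.HeisenbergGroup.SymplecticSiegelGeneration
import HarnessLib

/-!
# The unramified vector `1_{𝒪^ι}`: an eigenvector of every implementer of every integral symplectic element

Topic `RepresentationTheory/HeisenbergGroup`; namespace `Literature.RepresentationTheory.HeisenbergGroup`. KERNEL
mathematics only (one plumbing definition with body + theorems; no named fact, no `axiom`, no `sorry`).

For a non-archimedean local field `F` with `2 ∈ 𝒪_F^×`, a character `ψ` of conductor `𝒪_F` (conductor exponent
`0`), a Gram matrix `T ∈ GL_ι(F)` and the smooth Schrödinger model `ρ_T = schrodingerSB β_T ψ` of `H(W)`,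
`W = F^ι × F^ι`, `β_T(x, y) = ⟨x, T y⟩`, on `𝒮(F^ι)`:

* §1 (any model `ρ` of any `Heisenberg B`, any vector `Φ₀`) the elements `g ∈ Sp(V, B)` admitting an implementer
  `M` with `M Φ₀ ∈ kˣ Φ₀` form a SUBGROUP `eigenlineStabilizer ρ Φ₀` (implementers compose, [MoeglinVignerasWaldspurger1987]
  Chap. 2 II.1 (B)); when implementers are unique up to scalars, EVERY implementer of such a `g` has `Φ₀` as an
  eigenvector (`exists_smul_eq_of_mem_eigenlineStabilizer`).
* §2 **the unramified computation** ([MoeglinVignerasWaldspurger1987] Chap. 2 II.10; [GelbartRogawski1991] §3.1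
  (3.1.3); [Weil1964] n° 19–20): for `Φ₀ = 1_{𝒪^ι}` and the generators of the image of `Sp_{2ι}(R)`, `R` a local
  ring mapped into `𝒪_F` by `f` (e.g. `R = 𝒪_F`), transported to `Sp(W, A_T)` by `SymplecticMatrix.transportSp T`:
  the Levi elements `m(a)`, `a ∈ GL_ι(R)`, are implemented by `Φ ↦ Φ ∘ a⁻¹`, which FIXES `1_{𝒪^ι}`; the unipotents
  `n(c)`, `c ∈ Sym_ι(R)`, by multiplication by `ψ(-½⟨u, c u⟩)`, which FIXES `1_{𝒪^ι}` (`½⟨u, cu⟩ ∈ 𝒪` on `𝒪^ι`);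
  the Weyl element by the inverse Fourier transform (through the isomorphism of Heisenberg data `e_T : (x, y) ↦
  (x, Ty)` of `SchrodingerLeraySectionGram`), and `𝓕 1_{𝒪^ι} = μ^{⊗ι}(𝒪^ι) · 1_{𝒪^ι}`. Hence
  (`transportSp_mapHom_range_le_eigenlineStabilizer`, by `SymplecticMatrix.range_transportSp_mapHom_le` = the
  generation `Sp_{2ι}(R) = ⟨m(GL_ι(R)), n(Sym_ι(R)), J⟩` for local `R`): **every implementer of every element of the
  image of `Sp_{2ι}(R) → Sp(W, A_T)` maps `1_{𝒪^ι}` to a non-zero multiple of itself**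
  (`exists_smul_integersIndicator_of_implements`), in particular every normalised implementer section does
  (`ImplementerSection.exists_apply_integersIndicator_eq_smul`). This is the representation-theoretic core of the
  unramified clause of [GelbartRogawski1991] Prop. 3.1.1 / (3.1.3) ("`K_v` fixes the characteristic function of
  `𝒪_v^N` for almost all `v`"); the remaining scalar is fixed by the choice of splitting.

## References

* C. Mœglin, M.-F. Vignéras, J.-L. Waldspurger, LNM 1291 (1987), Chap. 2 II.1, II.6, II.10 [MoeglinVignerasWaldspurger1987].
* S. Gelbart, J. Rogawski, Invent. Math. 105 (1991), §3.1 (3.1.3), p. 456 [GelbartRogawski1991].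
* A. Weil, Acta Math. 111 (1964) 143–211: n° 13, n° 19–20 [Weil1964].
-/

set_option autoImplicit false

noncomputable section

namespace Literature.RepresentationTheory.HeisenbergGroup

open _root_.MeasureTheory Matrix
open Literature.NumberTheory.Automorphic
open Literature.NumberTheory.GaloisRepresentations.IsNonarchimedeanLocalField

/-! ## §1 The subgroup of elements with an implementer having a given eigenvector -/

section EigenSubgroup

variable {R : Type*} [CommRing R] [Invertible (2 : R)] {V : Type*} [AddCommGroup V] [Module R V]
  {B : V →ₗ[R] V →ₗ[R] R} {k : Type*} [Field k] {S : Type*} [AddCommGroup S] [Module k S]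
  (ρ : Representation k (Heisenberg B) S) (Φ₀ : S)

/-- **the subgroup of `g ∈ Sp(V, B)` admitting an implementer `M` (for the model `ρ`) with `M Φ₀ ∈ kˣ Φ₀`**
(non-Prop plumbing: implementers of `g`, `g'` compose to an implementer of `gg'`, [MoeglinVignerasWaldspurger1987]
Chap. 2 II.1 (B)). [cite: MoeglinVignerasWaldspurger1987, Chap. 2 II.1 (B)] -/
def eigenlineStabilizer : Subgroup (symplecticGroup B) where
  carrier := {g | ∃ M : S ≃ₗ[k] S, Implements ρ (ofSymplectic B g) M ∧ ∃ c : kˣ, M Φ₀ = (c : k) • Φ₀}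
  one_mem' := ⟨1, by rw [map_one]; exact Implements.one ρ, 1, by rw [Units.val_one, one_smul]; rfl⟩
  mul_mem' := by
    rintro g g' ⟨M, hM, c, hc⟩ ⟨M', hM', c', hc'⟩
    refine ⟨M * M', by rw [map_mul]; exact Implements.mul ρ hM hM', c' * c, ?_⟩
    rw [LinearEquiv.mul_apply, hc', map_smul, hc, smul_smul, Units.val_mul]
  inv_mem' := by
    rintro g ⟨M, hM, c, hc⟩
    refine ⟨M⁻¹, by rw [map_inv]; exact Implements.inv ρ hM, c⁻¹, ?_⟩
    have h := congrArg (M⁻¹ : S ≃ₗ[k] S) hc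
    rw [← LinearEquiv.mul_apply, inv_mul_cancel, map_smul] at h
    change Φ₀ = (c : k) • M⁻¹ Φ₀ at h
    calc M⁻¹ Φ₀ = ((c⁻¹ : kˣ) : k) • ((c : k) • M⁻¹ Φ₀) := by rw [smul_smul, Units.inv_mul, one_smul]
      _ = ((c⁻¹ : kˣ) : k) • Φ₀ := by rw [← h]

/-- membership unfolded. [cite: MoeglinVignerasWaldspurger1987, Chap. 2 II.1 (B)] -/
theorem mem_eigenlineStabilizer_iff (g : symplecticGroup B) :
    g ∈ eigenlineStabilizer ρ Φ₀ ↔ ∃ M : S ≃ₗ[k] S, Implements ρ (ofSymplectic B g) M ∧ ∃ c : kˣ, M Φ₀ = (c : k) • Φ₀ :=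
  Iff.rfl

/-- an implementer FIXING `Φ₀` puts `g` in the subgroup. [cite: MoeglinVignerasWaldspurger1987, Chap. 2 II.1 (B)] -/
theorem mem_eigenlineStabilizer_of_apply_eq {g : symplecticGroup B} {M : S ≃ₗ[k] S}
    (hM : Implements ρ (ofSymplectic B g) M) (h : M Φ₀ = Φ₀) : g ∈ eigenlineStabilizer ρ Φ₀ :=
  ⟨M, hM, 1, by rw [h, Units.val_one, one_smul]⟩

/-- **when implementers are unique up to scalars, EVERY implementer of an element of the subgroup has `Φ₀` as an
eigenvector.** [cite: MoeglinVignerasWaldspurger1987, Chap. 2 II.1 (A)–(B)] -/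
theorem exists_smul_eq_of_mem_eigenlineStabilizer (hU : ImplementerUniqueUpToScalar ρ) {g : symplecticGroup B}
    (hg : g ∈ eigenlineStabilizer ρ Φ₀) {M : S ≃ₗ[k] S} (hM : Implements ρ (ofSymplectic B g) M) :
    ∃ c : kˣ, M Φ₀ = (c : k) • Φ₀ := by
  obtain ⟨M₀, hM₀, c₀, hc₀⟩ := hg
  obtain ⟨c, hc⟩ := hU g M₀ M hM₀ hM
  exact ⟨c * c₀, by rw [hc Φ₀, hc₀, smul_smul, Units.val_mul]⟩

/-- … in particular every normalised implementer SECTION `r` has `r g Φ₀ ∈ kˣ Φ₀` on the subgroup.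
[cite: MoeglinVignerasWaldspurger1987, Chap. 2 II.1 (A)–(B)] -/
theorem ImplementerSection.exists_apply_eq_smul_of_mem (hU : ImplementerUniqueUpToScalar ρ)
    (r : ImplementerSection ρ) {g : symplecticGroup B} (hg : g ∈ eigenlineStabilizer ρ Φ₀) :
    ∃ c : kˣ, r g Φ₀ = (c : k) • Φ₀ :=
  exists_smul_eq_of_mem_eigenlineStabilizer ρ Φ₀ hU hg (r.implements g)

end EigenSubgroup

/-! ## §2 The unramified vector `1_{𝒪^ι}` of the Schrödinger model of a Gram duality -/

section Unramified

variable {F : Type*} [Field F] [ValuativeRel F] [TopologicalSpace F] [IsNonarchimedeanLocalField F]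
  {ι : Type*} [Fintype ι] [DecidableEq ι] [Invertible (2 : F)] (T : Matrix ι ι F) (hT : IsUnit T.det)
  {ψ : AddChar F Circle} (hl : IsLocallyConstant (⇑ψ : F → Circle))
  (hbT : ∀ y : ι → F, Continuous fun u : ι → F => Matrix.toLinearMap₂' F T u y)
  {R : Type*} [CommRing R] (f : R →+* F) (hf : ∀ r : R, f r ∈ primePowBall F 0)

local notation "𝕎" => ((ι → F) × (ι → F))
local notation "SpT" => (symplecticGroup (polar (Matrix.toLinearMap₂' F T)))
local notation "𝒪ι" => (piPrimePowBall F ι 0)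

/-! ### §2.1 Integral matrices preserve the box `𝒪^ι` -/

omit [Fintype ι] [DecidableEq ι] [Invertible (2 : F)] in
include hf in
/-- the entries of `map f A` lie in `𝒪`. [cite: WeilBNT1967, Ch. II §2] -/
private theorem map_entry_mem (A : Matrix ι ι R) (i j : ι) : (A.map f) i j ∈ primePowBall F 0 := hf (A i j)

omit [DecidableEq ι] [Invertible (2 : F)] in
/-- an `𝒪`-integral matrix maps `𝒪^ι` into `𝒪^ι`. [cite: WeilBNT1967, Ch. II §2, Prop. 4] -/
theorem mulVec_mem_piPrimePowBall_zero {A : Matrix ι ι F} (hA : ∀ i j, A i j ∈ primePowBall F 0) {u : ι → F}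
    (hu : u ∈ 𝒪ι) : A *ᵥ u ∈ 𝒪ι := by
  rw [mem_piPrimePowBall_iff] at hu ⊢
  intro i
  have h := dotProduct_mem_primePowBall (n := 0) (k := 0) (x := fun j => A i j) (y := u)
    ((mem_piPrimePowBall_iff).2 fun j => hA i j) ((mem_piPrimePowBall_iff).2 hu)
  rwa [add_zero] at h

omit [Invertible (2 : F)] in
include hf in
/-- for `a ∈ GL_ι(R)`: `u ∈ 𝒪^ι ↔ (f a)⁻¹ u ∈ 𝒪^ι`. [cite: WeilBNT1967, Ch. II §2, Prop. 4] -/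
theorem glEquiv_map_symm_mem_iff (a : GL ι R) (u : ι → F) :
    (SymplecticMatrix.glEquiv (Matrix.GeneralLinearGroup.map f a)).symm u ∈ 𝒪ι ↔ u ∈ 𝒪ι := by
  have hco : ∀ b : GL ι R, ∀ i j, ((Matrix.GeneralLinearGroup.map f b : GL ι F) : Matrix ι ι F) i j ∈
      primePowBall F 0 := fun b i j => map_entry_mem f hf (b : Matrix ι ι R) i j
  rw [SymplecticMatrix.glEquiv_symm_apply, ← map_inv]
  constructor
  · intro h
    have h' := mulVec_mem_piPrimePowBall_zero (hco a) h
    rwa [Matrix.mulVec_mulVec, ← Units.val_mul, ← map_mul, mul_inv_cancel, map_one, Units.val_one,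
      Matrix.one_mulVec] at h'
  · intro h
    exact mulVec_mem_piPrimePowBall_zero (hco a⁻¹) h

/-! ### §2.2 The three generators have implementers with eigenvector `1_{𝒪^ι}` -/

variable (Φ₀ : SchwartzBruhat (ι → F))
  (hΦ₀ : (Φ₀ : (ι → F) → ℂ) = (piPrimePowBall F ι 0).indicator fun _ => (1 : ℂ))  -- (no local notation in binders)

omit [ValuativeRel F] [IsNonarchimedeanLocalField F] [DecidableEq ι] [Invertible (2 : F)] in
/-- linear maps of `F^ι` are continuous. [folklore] -/
private theorem continuous_glEquiv' [IsTopologicalRing F] (a : (ι → F) ≃ₗ[F] (ι → F)) : Continuous a :=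
  (a : (ι → F) →ₗ[F] (ι → F)).continuous_on_pi

include hf hΦ₀ in
/-- **the Levi element `m(f a)`, `a ∈ GL_ι(R)`, is implemented by `Φ ↦ Φ ∘ (f a)⁻¹`, which fixes `1_{𝒪^ι}`**.
[cite: MoeglinVignerasWaldspurger1987, Chap. 2 II.6 and II.10; Weil1964, n° 13, p. 160] -/
theorem levi_mem_eigenlineStabilizer (a : GL ι R) :
    leviSp (Matrix.toLinearMap₂' F T) (SymplecticMatrix.glEquiv (Matrix.GeneralLinearGroup.map f a))
        (SymplecticMatrix.leviDual T hT (Matrix.GeneralLinearGroup.map f a)) (SymplecticMatrix.leviDual_compat T hT _)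
      ∈ eigenlineStabilizer (schrodingerSB (Matrix.toLinearMap₂' F T) ψ hl hbT) Φ₀ := by
  have hmem := levi_mem_MpPsi (Matrix.toLinearMap₂' F T) ψ hl hbT
    (SymplecticMatrix.glEquiv (Matrix.GeneralLinearGroup.map f a))
    (SymplecticMatrix.leviDual T hT (Matrix.GeneralLinearGroup.map f a)) (SymplecticMatrix.leviDual_compat T hT _)
    (continuous_glEquiv' _) (continuous_glEquiv' _)
  refine mem_eigenlineStabilizer_of_apply_eq _ Φ₀
    (M := leviEquivSB (SymplecticMatrix.glEquiv (Matrix.GeneralLinearGroup.map f a)) (continuous_glEquiv' _)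
      (continuous_glEquiv' _)) ((mem_MpPsi _ _).1 hmem) ?_
  apply Subtype.ext
  funext u
  rw [coe_leviEquivSB, leviOp_apply, hΦ₀]
  by_cases hu : u ∈ 𝒪ι
  · rw [Set.indicator_of_mem hu, Set.indicator_of_mem ((glEquiv_map_symm_mem_iff f hf a u).2 hu)]
  · rw [Set.indicator_of_notMem hu, Set.indicator_of_notMem (mt (glEquiv_map_symm_mem_iff f hf a u).1 hu)]

omit [ValuativeRel F] [TopologicalSpace F] [IsNonarchimedeanLocalField F] [Invertible (2 : F)] in
include hT in
/-- `β_T(x, lowLin T c x) = ⟨x, c x⟩`. [cite: Weil1964, n° 6, p. 151] -/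
private theorem toLinearMap₂'_lowLin (c : Matrix ι ι F) (x : ι → F) :
    Matrix.toLinearMap₂' F T x (SymplecticMatrix.lowLin T c x) = x ⬝ᵥ (c *ᵥ x) := by
  rw [Matrix.toLinearMap₂'_apply', SymplecticMatrix.lowLin_apply, Matrix.mulVec_mulVec,
    Matrix.mul_nonsing_inv_cancel_left _ _ hT]

include hT hf hΦ₀ in
/-- **the unipotent `n(f c)`, `c ∈ Sym_ι(R)`, is implemented by multiplication by `ψ(-½⟨u, (f c) u⟩)`, which fixes
`1_{𝒪^ι}`** when `ψ` has conductor `𝒪` and `½ ∈ 𝒪`. [cite: MoeglinVignerasWaldspurger1987, Chap. 2 II.6 and II.10; Weil1964, n° 13, p. 160] -/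
theorem unipotent_mem_eigenlineStabilizer (hm0 : ψ.HasConductorExp 0) (h2 : (⅟(2 : F) : F) ∈ primePowBall F 0)
    (c : Matrix ι ι R) (hc : c.IsSymm) :
    unipotentSp (Matrix.toLinearMap₂' F T) (SymplecticMatrix.lowLin T (c.map f))
        (SymplecticMatrix.lowLin_symm T hT (c.map f) (hc.map f))
      ∈ eigenlineStabilizer (schrodingerSB (Matrix.toLinearMap₂' F T) ψ hl hbT) Φ₀ := by
  have hq : Continuous fun x : ι → F =>
      ⅟(2 : F) * Matrix.toLinearMap₂' F T x (SymplecticMatrix.lowLin T (c.map f) x) := by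
    have : (fun x : ι → F => ⅟(2 : F) * Matrix.toLinearMap₂' F T x (SymplecticMatrix.lowLin T (c.map f) x)) =
        halfForm (Matrix.mulVecLin (c.map f)) := by
      funext x
      rw [toLinearMap₂'_lowLin T hT, halfForm_apply, Matrix.mulVecLin_apply]
    rw [this]
    exact continuous_halfForm _
  have hmem := unipotent_mem_MpPsi (Matrix.toLinearMap₂' F T) ψ hl hbT (SymplecticMatrix.lowLin T (c.map f))
    (SymplecticMatrix.lowLin_symm T hT (c.map f) (hc.map f)) hq
  refine mem_eigenlineStabilizer_of_apply_eq _ Φ₀ (M := unipotentEquivSB ψ hl _ hq) ((mem_MpPsi _ _).1 hmem) ?_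
  apply Subtype.ext
  funext u
  rw [coe_unipotentEquivSB, unipotentOp_apply, hΦ₀]
  by_cases hu : u ∈ 𝒪ι
  · have hmem : ⅟(2 : F) * Matrix.toLinearMap₂' F T u (SymplecticMatrix.lowLin T (c.map f) u) ∈ primePowBall F 0 := by
      rw [toLinearMap₂'_lowLin T hT]
      have h := mul_mem_primePowBall h2
        (dotProduct_mem_primePowBall (n := 0) (k := 0) hu
          (mulVec_mem_piPrimePowBall_zero (map_entry_mem f hf c) hu))
      rwa [add_zero, add_zero] at h
    rw [hm0.1 _ (neg_mem_primePowBall hmem), Circle.coe_one, one_mul]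
  · rw [Set.indicator_of_notMem hu, mul_zero]

variable (hb : ∀ y : ι → F, Continuous fun u : ι → F => dotProductBilin F F u y)
  [MeasurableSpace F] [BorelSpace F] (μ : Measure F) [μ.IsAddHaarMeasure]

omit [DecidableEq ι] [Invertible (2 : F)] in
/-- `μ^{⊗ι}(𝒪^ι) ≠ 0`. [cite: WeilBNT1967, Ch. VII §2, Cor. 3] -/
private theorem measureReal_integers_ne_zero (hψ : ψ.IsContinuousNontrivial) (hm0 : ψ.HasConductorExp 0) :
    (Measure.pi fun _ : ι => μ).real 𝒪ι ≠ 0 := by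
  haveI : SecondCountableTopology F := secondCountableTopology_localField F
  intro h0
  have h := measureReal_mul_measureReal_eq_piSelfDualConst (Measure.pi fun _ : ι => μ) hψ hm0 0
  rw [sub_zero, h0, zero_mul] at h
  exact (piSelfDualConst_pos (F := F) (ι := ι) (Measure.pi fun _ : ι => μ) (m := 0)).ne' h.symm

omit [DecidableEq ι] [Invertible (2 : F)] in
include hΦ₀ in
/-- **`𝓕 1_{𝒪^ι} = μ^{⊗ι}(𝒪^ι) · 1_{𝒪^ι}`** for `ψ` of conductor `𝒪` (`(1_{𝔭^N})^ = μ(𝔭^N) 1_{𝔭^{-N}}` at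
`N = 0`). [cite: WeilBNT1967, Ch. VII §2, Cor. 1; Weil1964, n° 19–20] -/
theorem fourierOpPi_integersIndicator (hψ : ψ.IsContinuousNontrivial) (hm0 : ψ.HasConductorExp 0) :
    fourierOpPi μ hψ hm0 Φ₀ = ((Measure.pi fun _ : ι => μ).real 𝒪ι : ℂ) • Φ₀ := by
  haveI : SecondCountableTopology F := secondCountableTopology_localField F
  apply Subtype.ext
  funext η
  rw [coe_fourierOpPi, hΦ₀, piFourierSB_indicator_piPrimePowBall _ hm0, sub_zero, Submodule.coe_smul,
    Pi.smul_apply, hΦ₀, smul_eq_mul]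
  by_cases hη : η ∈ 𝒪ι
  · rw [if_pos hη, Set.indicator_of_mem hη, mul_one]
  · rw [if_neg hη, Set.indicator_of_notMem hη, mul_zero]

omit [DecidableEq ι] [Invertible (2 : F)] in
include hΦ₀ in
/-- … hence `𝓕⁻¹ 1_{𝒪^ι} = μ^{⊗ι}(𝒪^ι)⁻¹ · 1_{𝒪^ι}`. [cite: WeilBNT1967, Ch. VII §2, Cor. 1] -/
theorem fourierOpPi_inv_integersIndicator (hψ : ψ.IsContinuousNontrivial) (hm0 : ψ.HasConductorExp 0) :
    (fourierOpPi μ hψ hm0)⁻¹ Φ₀ = (((Measure.pi fun _ : ι => μ).real 𝒪ι : ℂ))⁻¹ • Φ₀ := by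
  have hκ : ((Measure.pi fun _ : ι => μ).real 𝒪ι : ℂ) ≠ 0 :=
    Complex.ofReal_ne_zero.2 (measureReal_integers_ne_zero (F := F) (ι := ι) μ hψ hm0)
  have h := congrArg ((fourierOpPi μ hψ hm0)⁻¹ : _ ≃ₗ[ℂ] _) (fourierOpPi_integersIndicator Φ₀ hΦ₀ μ hψ hm0)
  rw [← LinearEquiv.mul_apply, inv_mul_cancel, map_smul] at h
  change Φ₀ = _ at h
  calc (fourierOpPi μ hψ hm0)⁻¹ Φ₀
      = (((Measure.pi fun _ : ι => μ).real 𝒪ι : ℂ))⁻¹ •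
          ((((Measure.pi fun _ : ι => μ).real 𝒪ι : ℂ)) • (fourierOpPi μ hψ hm0)⁻¹ Φ₀) := by
        rw [smul_smul, inv_mul_cancel₀ hκ, one_smul]
    _ = (((Measure.pi fun _ : ι => μ).real 𝒪ι : ℂ))⁻¹ • Φ₀ := by rw [← h]

omit [ValuativeRel F] [TopologicalSpace F] [IsNonarchimedeanLocalField F] [Invertible (2 : F)] [MeasurableSpace F] in
include hT in
/-- `e_T⁻¹ (x, y) = (x, T⁻¹ y)`. [cite: Weil1964, n° 34, p. 182] -/
theorem gramProd_symm_apply (v : 𝕎) : (gramProd T hT).symm v = (v.1, T⁻¹ *ᵥ v.2) := by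
  rw [LinearEquiv.symm_apply_eq, gramProd_apply, Matrix.mulVec_mulVec, Matrix.mul_nonsing_inv _ hT,
    Matrix.one_mulVec]

omit [ValuativeRel F] [TopologicalSpace F] [IsNonarchimedeanLocalField F] [Invertible (2 : F)] [MeasurableSpace F]
  [BorelSpace F] in
include hT in
/-- `e_T w_T = 𝐰⁻¹ e_T`: through `e_T : (x, y) ↦ (x, Ty)` the transported Weyl element `(x, y) ↦ (-Ty, T⁻¹x)` of
`β_T` becomes the INVERSE of the standard Weyl element `(x, y) ↦ (y, -x)`. [cite: Weil1964, n° 34, p. 182] -/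
theorem symplecticConj_gramProd_weyl :
    symplecticConj (gramProd T hT) (polar_dotProductBilin_gramProd T hT)
        (weylSp (Matrix.toLinearMap₂' F T) (SymplecticMatrix.weylGamma T hT) (SymplecticMatrix.gramEquiv T hT).symm
          (SymplecticMatrix.weylGamma_compat T hT)) =
      (weylSp (dotProductBilin F F (m := ι)) (LinearEquiv.refl F (ι → F)) (LinearEquiv.neg F)
        dotProductBilin_refl_neg')⁻¹ := by
  rw [eq_inv_iff_mul_eq_one]
  apply Subtype.ext
  refine LinearEquiv.ext fun v => ?_
  rw [Subgroup.coe_mul, LinearEquiv.mul_apply, Subgroup.coe_one]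
  change _ = v
  simp only [symplecticConj_apply, coe_weylSp, weylσ_apply, gramProd_apply, gramProd_symm_apply T hT,
    LinearEquiv.refl_apply, LinearEquiv.neg_apply, SymplecticMatrix.weylGamma_apply,
    SymplecticMatrix.gramEquiv_symm_apply, Matrix.mulVec_neg, Matrix.mulVec_mulVec, Matrix.mul_nonsing_inv _ hT,
    Matrix.one_mulVec, neg_neg, Prod.mk.eta]

include hT hb hΦ₀ μ in
/-- **the Weyl element of `β_T` is implemented by the inverse Fourier transform, which maps `1_{𝒪^ι}` to
`μ^{⊗ι}(𝒪^ι)⁻¹ · 1_{𝒪^ι}`** (through `ρ_T = ρ_1 ∘ e_T`). [cite: MoeglinVignerasWaldspurger1987, Chap. 2 II.6 and II.10; Weil1964, n° 13, n° 34] -/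
theorem weyl_mem_eigenlineStabilizer (hψ : ψ.IsContinuousNontrivial) (hm0 : ψ.HasConductorExp 0) :
    weylSp (Matrix.toLinearMap₂' F T) (SymplecticMatrix.weylGamma T hT) (SymplecticMatrix.gramEquiv T hT).symm
        (SymplecticMatrix.weylGamma_compat T hT)
      ∈ eigenlineStabilizer (schrodingerSB (Matrix.toLinearMap₂' F T) ψ hl hbT) Φ₀ := by
  haveI : SecondCountableTopology F := secondCountableTopology_localField F
  have hF : Implements (schrodingerSB (dotProductBilin F F (m := ι)) ψ hl hb)
      (ofSymplectic _ (weylSp (dotProductBilin F F (m := ι)) (LinearEquiv.refl F (ι → F)) (LinearEquiv.neg F)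
        dotProductBilin_refl_neg')⁻¹) (fourierOpPi μ hψ hm0)⁻¹ := by
    rw [map_inv]
    exact Implements.inv _ ((mem_MpPsi _ _).1 (weyl_fourierOpPi_mem_MpPsi hl hb μ hψ hm0))
  rw [← symplecticConj_gramProd_weyl T hT] at hF
  have hM := (implements_iff_implements_symplecticConj (gramProd T hT) (polar_dotProductBilin_gramProd T hT)
    (schrodingerSB_gram_eq T hT hl hb hbT (ψ := ψ)) _ _).2 hF
  refine ⟨_, hM, Units.mk0 _ (inv_ne_zero (Complex.ofReal_ne_zero.2
    (measureReal_integers_ne_zero (F := F) (ι := ι) μ hψ hm0))), ?_⟩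
  rw [Units.val_mk0]
  exact fourierOpPi_inv_integersIndicator Φ₀ hΦ₀ μ hψ hm0

/-! ### §2.3 The image of `Sp_{2ι}(R)` and all its implementers -/

include hf hb μ hΦ₀ in
/-- **the whole image of `Sp_{2ι}(R) → Sp(W, A_T)` (`R` local, `f(R) ⊆ 𝒪`) lies in the eigenline stabiliser of
`1_{𝒪^ι}`** — generation of `Sp_{2ι}(R)` by `m(GL_ι(R))`, `n(Sym_ι(R))`, `J` + §2.2.
[cite: MoeglinVignerasWaldspurger1987, Chap. 2 II.5 and II.10; GelbartRogawski1991, §3.1 (3.1.3), p. 456] -/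
theorem transportSp_mapHom_range_le_eigenlineStabilizer [IsLocalRing R] (hψ : ψ.IsContinuousNontrivial)
    (hm0 : ψ.HasConductorExp 0) (h2 : (⅟(2 : F) : F) ∈ primePowBall F 0) :
    ((SymplecticMatrix.transportSp T hT).comp (SymplecticMatrix.mapHom f)).range ≤
      eigenlineStabilizer (schrodingerSB (Matrix.toLinearMap₂' F T) ψ hl hbT) Φ₀ :=
  SymplecticMatrix.range_transportSp_mapHom_le f T hT (fun a => levi_mem_eigenlineStabilizer T hT hl hbT f hf Φ₀ hΦ₀ a)
    (fun c hc => unipotent_mem_eigenlineStabilizer T hT hl hbT f hf Φ₀ hΦ₀ hm0 h2 c hc)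
    (weyl_mem_eigenlineStabilizer T hT hl hbT Φ₀ hΦ₀ hb μ hψ hm0)

include hf hb μ hΦ₀ in
/-- **THE UNRAMIFIED EIGENVECTOR PROPERTY**: for `R` local with `f(R) ⊆ 𝒪_F` (e.g. `R = 𝒪_F`), `ψ` of conductor `𝒪_F`,
`2 ∈ 𝒪_F^×`: EVERY implementer `M` (on `𝒮(F^ι)`, model `ρ_T`) of EVERY element `transportSp T (f A)`,
`A ∈ Sp_{2ι}(R)`, satisfies `M 1_{𝒪^ι} = c · 1_{𝒪^ι}` for some `c ∈ ℂˣ`.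
[cite: MoeglinVignerasWaldspurger1987, Chap. 2 II.10; GelbartRogawski1991, §3.1 (3.1.3), p. 456] -/
theorem exists_smul_integersIndicator_of_implements [IsLocalRing R] (hψ : ψ.IsContinuousNontrivial)
    (hm0 : ψ.HasConductorExp 0) (h2 : (⅟(2 : F) : F) ∈ primePowBall F 0)
    (hU : ImplementerUniqueUpToScalar (schrodingerSB (Matrix.toLinearMap₂' F T) ψ hl hbT))
    (A : Matrix.symplecticGroup ι R) {M : SchwartzBruhat (ι → F) ≃ₗ[ℂ] SchwartzBruhat (ι → F)}
    (hM : Implements (schrodingerSB (Matrix.toLinearMap₂' F T) ψ hl hbT)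
      (ofSymplectic _ (SymplecticMatrix.transportSp T hT (SymplecticMatrix.mapHom f A))) M) :
    ∃ c : ℂˣ, M Φ₀ = (c : ℂ) • Φ₀ :=
  exists_smul_eq_of_mem_eigenlineStabilizer _ Φ₀ hU
    (transportSp_mapHom_range_le_eigenlineStabilizer T hT hl hbT f hf Φ₀ hΦ₀ hb μ hψ hm0 h2 ⟨A, rfl⟩) hM

include hf hb μ hΦ₀ in
/-- … and every normalised implementer section `r` of `ρ_T` has `r(transportSp T (f A)) 1_{𝒪^ι} ∈ ℂˣ 1_{𝒪^ι}`.
[cite: MoeglinVignerasWaldspurger1987, Chap. 2 II.10; GelbartRogawski1991, §3.1 (3.1.3), p. 456] -/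
theorem ImplementerSection.exists_apply_integersIndicator_eq_smul [IsLocalRing R] (hψ : ψ.IsContinuousNontrivial)
    (hm0 : ψ.HasConductorExp 0) (h2 : (⅟(2 : F) : F) ∈ primePowBall F 0)
    (hU : ImplementerUniqueUpToScalar (schrodingerSB (Matrix.toLinearMap₂' F T) ψ hl hbT))
    (r : ImplementerSection (schrodingerSB (Matrix.toLinearMap₂' F T) ψ hl hbT)) (A : Matrix.symplecticGroup ι R) :
    ∃ c : ℂˣ, r (SymplecticMatrix.transportSp T hT (SymplecticMatrix.mapHom f A)) Φ₀ = (c : ℂ) • Φ₀ :=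
  exists_smul_integersIndicator_of_implements T hT hl hbT f hf Φ₀ hΦ₀ hb μ hψ hm0 h2 hU A (r.implements _)

end Unramified

end Literature.RepresentationTheory.HeisenbergGroup
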